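import Summits.AnomalousDissipation.AnomalousDissipation.Theses.RuelleSaturation

/-!
# Line `split-window-capture` for crux KolmogorovHorizonChaos (stmt-AnomalousDissipation-1285)

Crux-strategist typed decomposition (BC2 redirect of the RESTATED deciding crux), registered as a
skeleton line: three stubs = the three pieces

* `stub_windowDissipationFloor`   — W : transient zeroth law on finite windows (Eulerian; crux),
* `stub_kolmogorovHorizonCapture` — K : universal Kolmogorov-horizon FTLE capture (Lagrangian; crux),
* `stub_floorEternalisation`      — Fl: floor eternalisation at fixed viscosity (known-type analysis; support),

and the kernel-checked composition `KolmogorovHorizonChaos_of : KolmogorovHorizonChaos` from the named stubs (no sorry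
outside the stubs); the hypothesis form `W → K → Fl → KolmogorovHorizonChaos` is `SplitAssembly.lean` in this crux directory.  Piece probes `W/K/Fl → AnomalousDissipation` and `→ KolmogorovHorizonChaos`
(`first | exact? | simpa | aesop`, 400k heartbeats) fail 6/6; see `Lines/split-window-capture.md`.
-/

open MeasureTheory Filter Topology Set

noncomputable section

namespace Summit.AnomalousDissipation.AnomalousDissipation.Cruxes.KolmogorovHorizonChaos.SplitWindowCapture

/-- STUB W (crux piece 1/3): TRANSIENT ZEROTH LAW AT BOUNDED ENERGY, level-wise smooth — one steady
force, `ν_j → 0`, uniform `E₀, c, L₁`, level-wise smoothness budgets `B_j`; for every window length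
`L ≥ L₁` a globally smooth slice-wise div-free field solving NS on `[0, L]` with energy `≤ E₀`, budget
`B_j`, and `ν_j ∫₀ᴸ ‖∇u‖² ≥ c L`.  Data re-chosen per window: no global solution per level (not the
summit), nothing Lagrangian (not the crux). -/
theorem stub_windowDissipationFloor :
    ∃ f : UnitAddTorus (Fin 3) → EuclideanSpace ℝ (Fin 3), Literature.Analysis.FunctionSpaces.Torus.IsSmooth f ∧ Literature.Analysis.FunctionSpaces.Torus.IsDivFree f ∧ Literature.Analysis.FunctionSpaces.Torus.HasZeroMean f ∧
    ∃ ν : ℕ → ℝ, (∀ j, 0 < ν j ∧ ν j ≤ 1) ∧ Filter.Tendsto ν Filter.atTop (nhds 0) ∧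
    ∃ E₀ c L₁ : ℝ, 0 < c ∧ ∀ j, ∃ B : ℕ → ℝ, ∀ L : ℝ, L₁ ≤ L →
    ∃ (u : ℝ → UnitAddTorus (Fin 3) → EuclideanSpace ℝ (Fin 3)) (p : ℝ → UnitAddTorus (Fin 3) → ℝ),
    Literature.Analysis.FunctionSpaces.Torus.IsSmoothSpaceTimeOn Set.univ u ∧ Literature.Analysis.FunctionSpaces.Torus.IsSmoothSpaceTimeOn Set.univ p ∧
    (∀ t, Literature.Analysis.FunctionSpaces.Torus.IsDivFree (u t)) ∧
    Literature.Analysis.FunctionSpaces.Torus.IsClassicalNSSolutionOn (Set.Icc 0 L) (ν j) (fun _ => f) u p ∧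
    (∀ t ∈ Set.Icc 0 L, MeasureTheory.integral MeasureTheory.volume (fun x : UnitAddTorus (Fin 3) => ‖u t x‖ ^ 2) ≤ E₀) ∧
    (∀ k : ℕ, ∀ q ∈ (Set.Icc 0 L) ×ˢ (Set.univ : Set (EuclideanSpace ℝ (Fin 3))),
    ‖iteratedFDeriv ℝ k (Literature.Analysis.FunctionSpaces.Torus.stLift u) q‖ ≤ B k ∧ ‖iteratedFDeriv ℝ k (Literature.Analysis.FunctionSpaces.Torus.stLift p) q‖ ≤ B k) ∧
    c * L ≤ ν j * ∫ t in (0 : ℝ)..L, Literature.Analysis.FunctionSpaces.Torus.gradNormSq (u t) := by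
  sorry

/-- STUB K (crux piece 2/3): KOLMOGOROV-HORIZON CAPTURE — `∀ f E₀ ∃ M κ β`: every bounded-energy
window solution admits Lagrangian data whose FTLE over the horizon `√(ν/M)` captures the fraction
`κ` of the windowed dissipation up to the transient allowance `β`.  Universal/conditional. -/
theorem stub_kolmogorovHorizonCapture :
    ∀ f : UnitAddTorus (Fin 3) → EuclideanSpace ℝ (Fin 3), Literature.Analysis.FunctionSpaces.Torus.IsSmooth f → Literature.Analysis.FunctionSpaces.Torus.IsDivFree f → Literature.Analysis.FunctionSpaces.Torus.HasZeroMean f →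
    ∀ E₀ : ℝ, ∃ M κ β : ℝ, 0 < M ∧ 0 < κ ∧ ∀ ν : ℝ, 0 < ν → ν ≤ 1 → ∀ L : ℝ, 0 ≤ L →
    ∀ (u : ℝ → UnitAddTorus (Fin 3) → EuclideanSpace ℝ (Fin 3)) (p : ℝ → UnitAddTorus (Fin 3) → ℝ),
    Literature.Analysis.FunctionSpaces.Torus.IsSmoothSpaceTimeOn Set.univ u → (∀ t, Literature.Analysis.FunctionSpaces.Torus.IsDivFree (u t)) →
    Literature.Analysis.FunctionSpaces.Torus.IsClassicalNSSolutionOn (Set.Icc 0 (L + Real.sqrt (ν / M))) ν (fun _ => f) u p →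
    (∀ t ∈ Set.Icc 0 (L + Real.sqrt (ν / M)), MeasureTheory.integral MeasureTheory.volume (fun x : UnitAddTorus (Fin 3) => ‖u t x‖ ^ 2) ≤ E₀) →
    ∃ (D : ℝ → ℝ → UnitAddTorus (Fin 3) → EuclideanSpace ℝ (Fin 3)) (J : ℝ → ℝ → UnitAddTorus (Fin 3) → (EuclideanSpace ℝ (Fin 3) →L[ℝ] EuclideanSpace ℝ (Fin 3))),
    ((∀ t x, D t t x = 0) ∧
    (∀ t s x, HasDerivAt (fun r => D t r x) (u s (x + Literature.Analysis.FunctionSpaces.Torus.proj (D t s x))) s) ∧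
    (∀ t x, J t t x = ContinuousLinearMap.id ℝ (EuclideanSpace ℝ (Fin 3))) ∧
    (∀ t s x, HasDerivAt (fun r => J t r x) ((Literature.Analysis.FunctionSpaces.Torus.fderiv (u s) (x + Literature.Analysis.FunctionSpaces.Torus.proj (D t s x))).comp (J t s x)) s) ∧
    (∀ t s, MeasureTheory.MeasurePreserving (fun x : UnitAddTorus (Fin 3) => x + Literature.Analysis.FunctionSpaces.Torus.proj (D t s x)) MeasureTheory.volume MeasureTheory.volume) ∧
    Continuous (fun q : ℝ × ℝ × UnitAddTorus (Fin 3) => (D q.1 q.2.1 q.2.2, J q.1 q.2.1 q.2.2))) ∧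
    κ * (ν * ∫ t in (0 : ℝ)..(L + Real.sqrt (ν / M)), Literature.Analysis.FunctionSpaces.Torus.gradNormSq (u t)) - β ≤
    ν * ∫ t in (0 : ℝ)..L, MeasureTheory.integral MeasureTheory.volume
    (fun x : UnitAddTorus (Fin 3) => ((Real.sqrt (ν / M))⁻¹ * Real.log ‖J t (t + Real.sqrt (ν / M)) x‖) ^ 2) := by
  sorry

/-- STUB Fl (support piece 3/3): FLOOR ETERNALISATION AT FIXED VISCOSITY — window witnesses with
budgets uniform in the window length and FTLE window floor `a·L` yield an eternal classical witness
with Lagrangian data, energy `≤ E₀`, affine FTLE mass bound and frequent window floor `(a/2)·T`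
(tiling lemma for Cesàro floors + Arzelà–Ascoli + ODE stability). -/
theorem stub_floorEternalisation :
    ∀ (ν : ℝ) (f : UnitAddTorus (Fin 3) → EuclideanSpace ℝ (Fin 3)) (τ E₀ L₀ a : ℝ) (B : ℕ → ℝ),
    0 < ν → Literature.Analysis.FunctionSpaces.Torus.IsSmooth f → 0 < τ →
    (∀ L : ℝ, L₀ ≤ L →
    ∃ (u : ℝ → UnitAddTorus (Fin 3) → EuclideanSpace ℝ (Fin 3)) (p : ℝ → UnitAddTorus (Fin 3) → ℝ)
    (D : ℝ → ℝ → UnitAddTorus (Fin 3) → EuclideanSpace ℝ (Fin 3)) (J : ℝ → ℝ → UnitAddTorus (Fin 3) → (EuclideanSpace ℝ (Fin 3) →L[ℝ] EuclideanSpace ℝ (Fin 3))),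
    Literature.Analysis.FunctionSpaces.Torus.IsSmoothSpaceTimeOn Set.univ u ∧ Literature.Analysis.FunctionSpaces.Torus.IsSmoothSpaceTimeOn Set.univ p ∧
    (∀ t, Literature.Analysis.FunctionSpaces.Torus.IsDivFree (u t)) ∧
    Literature.Analysis.FunctionSpaces.Torus.IsClassicalNSSolutionOn (Set.Icc 0 (L + τ)) ν (fun _ => f) u p ∧
    ((∀ t x, D t t x = 0) ∧
    (∀ t s x, HasDerivAt (fun r => D t r x) (u s (x + Literature.Analysis.FunctionSpaces.Torus.proj (D t s x))) s) ∧
    (∀ t x, J t t x = ContinuousLinearMap.id ℝ (EuclideanSpace ℝ (Fin 3))) ∧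
    (∀ t s x, HasDerivAt (fun r => J t r x) ((Literature.Analysis.FunctionSpaces.Torus.fderiv (u s) (x + Literature.Analysis.FunctionSpaces.Torus.proj (D t s x))).comp (J t s x)) s) ∧
    (∀ t s, MeasureTheory.MeasurePreserving (fun x : UnitAddTorus (Fin 3) => x + Literature.Analysis.FunctionSpaces.Torus.proj (D t s x)) MeasureTheory.volume MeasureTheory.volume) ∧
    Continuous (fun q : ℝ × ℝ × UnitAddTorus (Fin 3) => (D q.1 q.2.1 q.2.2, J q.1 q.2.1 q.2.2))) ∧
    (∀ t ∈ Set.Icc 0 (L + τ), MeasureTheory.integral MeasureTheory.volume (fun x : UnitAddTorus (Fin 3) => ‖u t x‖ ^ 2) ≤ E₀) ∧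
    (∀ k : ℕ, ∀ q ∈ (Set.Icc 0 (L + τ)) ×ˢ (Set.univ : Set (EuclideanSpace ℝ (Fin 3))),
    ‖iteratedFDeriv ℝ k (Literature.Analysis.FunctionSpaces.Torus.stLift u) q‖ ≤ B k ∧ ‖iteratedFDeriv ℝ k (Literature.Analysis.FunctionSpaces.Torus.stLift p) q‖ ≤ B k) ∧
    a * L ≤ ∫ t in (0 : ℝ)..L, MeasureTheory.integral MeasureTheory.volume
    (fun x : UnitAddTorus (Fin 3) => (τ⁻¹ * Real.log ‖J t (t + τ) x‖) ^ 2)) →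
    ∃ (u : ℝ → UnitAddTorus (Fin 3) → EuclideanSpace ℝ (Fin 3)) (p : ℝ → UnitAddTorus (Fin 3) → ℝ)
    (D : ℝ → ℝ → UnitAddTorus (Fin 3) → EuclideanSpace ℝ (Fin 3)) (J : ℝ → ℝ → UnitAddTorus (Fin 3) → (EuclideanSpace ℝ (Fin 3) →L[ℝ] EuclideanSpace ℝ (Fin 3))),
    Literature.Analysis.FunctionSpaces.Torus.IsClassicalNSSolutionOn Set.univ ν (fun _ => f) u p ∧
    ((∀ t x, D t t x = 0) ∧
    (∀ t s x, HasDerivAt (fun r => D t r x) (u s (x + Literature.Analysis.FunctionSpaces.Torus.proj (D t s x))) s) ∧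
    (∀ t x, J t t x = ContinuousLinearMap.id ℝ (EuclideanSpace ℝ (Fin 3))) ∧
    (∀ t s x, HasDerivAt (fun r => J t r x) ((Literature.Analysis.FunctionSpaces.Torus.fderiv (u s) (x + Literature.Analysis.FunctionSpaces.Torus.proj (D t s x))).comp (J t s x)) s) ∧
    (∀ t s, MeasureTheory.MeasurePreserving (fun x : UnitAddTorus (Fin 3) => x + Literature.Analysis.FunctionSpaces.Torus.proj (D t s x)) MeasureTheory.volume MeasureTheory.volume) ∧
    Continuous (fun q : ℝ × ℝ × UnitAddTorus (Fin 3) => (D q.1 q.2.1 q.2.2, J q.1 q.2.1 q.2.2))) ∧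
    (∀ t, MeasureTheory.integral MeasureTheory.volume (fun x : UnitAddTorus (Fin 3) => ‖u t x‖ ^ 2) ≤ E₀) ∧
    (∃ Bd : ℝ, ∀ T : ℝ, 0 ≤ T → ∫ t in (0 : ℝ)..T, MeasureTheory.integral MeasureTheory.volume
    (fun x : UnitAddTorus (Fin 3) => (τ⁻¹ * Real.log ‖J t (t + τ) x‖) ^ 2) ≤ Bd * (T + 1)) ∧
    (∀ n : ℕ, ∃ T : ℝ, (n : ℝ) + 1 ≤ T ∧ a / 2 * T ≤ ∫ t in (0 : ℝ)..T, MeasureTheory.integral MeasureTheory.volume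
    (fun x : UnitAddTorus (Fin 3) => (τ⁻¹ * Real.log ‖J t (t + τ) x‖) ^ 2)) := by
  sorry

/-- Cesàro-floor lemma used by the assembly: if the running means of a real function are eventually
bounded above and exceed `b` on arbitrarily long windows `[0, T]`, then `b ≤ longTimeAvgSup g`. -/
theorem le_longTimeAvgSup_of_frequently {g : ℝ → ℝ} {b Bd : ℝ}
    (hBd : ∀ T : ℝ, 0 ≤ T → ∫ t in (0 : ℝ)..T, g t ≤ Bd * (T + 1))
    (hfreq : ∀ n : ℕ, ∃ T : ℝ, (n : ℝ) + 1 ≤ T ∧ b * T ≤ ∫ t in (0 : ℝ)..T, g t) :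
    b ≤ Literature.Analysis.FluidPDE.longTimeAvgSup g := by
  unfold Literature.Analysis.FluidPDE.longTimeAvgSup
  have hbdd : Filter.IsBoundedUnder (· ≤ ·) Filter.atTop (Literature.Analysis.FluidPDE.timeMean g) := by
    refine Filter.isBoundedUnder_of_eventually_le (a := |Bd| * 2) ?_
    filter_upwards [Filter.eventually_ge_atTop (1 : ℝ)] with T hT
    have hT0 : 0 < T := by linarith
    unfold Literature.Analysis.FluidPDE.timeMean
    have h1 : ∫ t in (0 : ℝ)..T, g t ≤ |Bd| * 2 * T := by
      calc ∫ t in (0 : ℝ)..T, g t ≤ Bd * (T + 1) := hBd T hT0.le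
        _ ≤ |Bd| * (T + 1) := by
            exact mul_le_mul_of_nonneg_right (le_abs_self Bd) (by linarith)
        _ ≤ |Bd| * 2 * T := by nlinarith [abs_nonneg Bd]
    rw [inv_mul_le_iff₀ hT0]
    linarith
  have hfr : ∃ᶠ T in Filter.atTop, b ≤ Literature.Analysis.FluidPDE.timeMean g T := by
    rw [Filter.frequently_atTop]
    intro T₀
    obtain ⟨T, hT, hbT⟩ := hfreq ⌈T₀⌉₊
    have hT0 : 0 < T := by
      have := Nat.cast_nonneg (α := ℝ) ⌈T₀⌉₊
      linarith
    refine ⟨T, ?_, ?_⟩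
    · have := Nat.le_ceil T₀
      linarith
    · unfold Literature.Analysis.FluidPDE.timeMean
      rw [le_inv_mul_iff₀ hT0]
      linarith
  exact Filter.le_limsup_of_frequently_le hfr hbdd

/-- **The crux BY NAME from the three registered stubs** (skeleton shape: the FIRST theorem concluding the
crux; no hypotheses; sorries only inside `stub_*`).  Horizons `τ_j := √(ν_j/M)`; per level the W-window on
`[0, L+τ_j]` gets Lagrangian data and the capture inequality from K, giving the FTLE window floor `(κc/(2ν_j))·L`
once `κcL ≥ 2β`; Fl eternalises; the Cesàro lemma turns "bounded running means + frequently mean ≥ κc/(4ν_j)"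
into `ν_j · longTimeAvgSup ≥ κc/4`, uniformly in `j`. -/
theorem KolmogorovHorizonChaos_of :
    Summit.AnomalousDissipation.AnomalousDissipation.Theses.RuelleSaturation.KolmogorovHorizonChaos := by
  have hW := stub_windowDissipationFloor
  have hK := stub_kolmogorovHorizonCapture
  have hE := stub_floorEternalisation
  obtain ⟨f, hfs, hfd, hfm, ν, hν, hν0, E₀, c, L₁, hc, hWj⟩ := hW
  obtain ⟨M, κ, β, hM, hκ, hKν⟩ := hK f hfs hfd hfm E₀
  have hτpos : ∀ j, 0 < Real.sqrt (ν j / M) := fun j => Real.sqrt_pos.2 (div_pos (hν j).1 hM)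
  have hτsq : ∀ j, ν j = M * Real.sqrt (ν j / M) ^ 2 := by
    intro j
    rw [Real.sq_sqrt (div_pos (hν j).1 hM).le]
    field_simp
  have hκc : 0 < κ * c := mul_pos hκ hc
  -- per-level eternal witnesses
  have key : ∀ j, ∃ (u : ℝ → UnitAddTorus (Fin 3) → EuclideanSpace ℝ (Fin 3)) (p : ℝ → UnitAddTorus (Fin 3) → ℝ)
      (D : ℝ → ℝ → UnitAddTorus (Fin 3) → EuclideanSpace ℝ (Fin 3)) (J : ℝ → ℝ → UnitAddTorus (Fin 3) → (EuclideanSpace ℝ (Fin 3) →L[ℝ] EuclideanSpace ℝ (Fin 3))),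
      Literature.Analysis.FunctionSpaces.Torus.IsClassicalNSSolutionOn Set.univ (ν j) (fun _ => f) u p ∧
      ((∀ t x, D t t x = 0) ∧
        (∀ t s x, HasDerivAt (fun r => D t r x) (u s (x + Literature.Analysis.FunctionSpaces.Torus.proj (D t s x))) s) ∧
        (∀ t x, J t t x = ContinuousLinearMap.id ℝ (EuclideanSpace ℝ (Fin 3))) ∧
        (∀ t s x, HasDerivAt (fun r => J t r x) ((Literature.Analysis.FunctionSpaces.Torus.fderiv (u s) (x + Literature.Analysis.FunctionSpaces.Torus.proj (D t s x))).comp (J t s x)) s) ∧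
        (∀ t s, MeasureTheory.MeasurePreserving (fun x : UnitAddTorus (Fin 3) => x + Literature.Analysis.FunctionSpaces.Torus.proj (D t s x)) MeasureTheory.volume MeasureTheory.volume) ∧
        Continuous (fun q : ℝ × ℝ × UnitAddTorus (Fin 3) => (D q.1 q.2.1 q.2.2, J q.1 q.2.1 q.2.2))) ∧
      (∀ t, MeasureTheory.integral MeasureTheory.volume (fun x : UnitAddTorus (Fin 3) => ‖u t x‖ ^ 2) ≤ E₀) ∧
      (∃ Bd : ℝ, ∀ T : ℝ, 0 ≤ T → ∫ t in (0 : ℝ)..T, MeasureTheory.integral MeasureTheory.volume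
          (fun x : UnitAddTorus (Fin 3) => ((Real.sqrt (ν j / M))⁻¹ * Real.log ‖J t (t + Real.sqrt (ν j / M)) x‖) ^ 2) ≤ Bd * (T + 1)) ∧
      (∀ n : ℕ, ∃ T : ℝ, (n : ℝ) + 1 ≤ T ∧ (κ * c / (2 * ν j)) / 2 * T ≤ ∫ t in (0 : ℝ)..T, MeasureTheory.integral MeasureTheory.volume
          (fun x : UnitAddTorus (Fin 3) => ((Real.sqrt (ν j / M))⁻¹ * Real.log ‖J t (t + Real.sqrt (ν j / M)) x‖) ^ 2)) := by
    intro j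
    obtain ⟨B, hB⟩ := hWj j
    have hνj := (hν j).1
    -- threshold
    set L₀ : ℝ := max (max L₁ 0) (2 * β / (κ * c)) with hL₀
    have hmain := hE (ν j) f (Real.sqrt (ν j / M)) E₀ L₀ (κ * c / (2 * ν j)) B hνj hfs (hτpos j)
    refine hmain ?_
    intro L hL
    have hL1 : L₁ ≤ L := le_trans (le_trans (le_max_left _ _) (le_max_left _ _)) hL
    have hL0 : 0 ≤ L := le_trans (le_trans (le_max_right _ _) (le_max_left _ _)) hL
    have hLβ : 2 * β / (κ * c) ≤ L := le_trans (le_max_right _ _) hL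
    have hLβ' : 2 * β ≤ κ * c * L := by
      rw [div_le_iff₀ hκc] at hLβ
      linarith
    obtain ⟨u, p, hu, hp, hdiv, hNS, hEn, hBud, hfloor⟩ :=
      hB (L + Real.sqrt (ν j / M)) (by linarith [(hτpos j).le])
    obtain ⟨D, J, hLF, hcap⟩ := hKν (ν j) hνj (hν j).2 L hL0 u p hu hdiv hNS hEn
    refine ⟨u, p, D, J, hu, hp, hdiv, hNS, hLF, hEn, hBud, ?_⟩
    -- arithmetic: κ c (L + τ) - β ≤ ν · mass and κ c L ≥ 2β  ⟹  (κc/(2ν)) L ≤ mass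
    set I₁ : ℝ := ∫ t in (0 : ℝ)..(L + Real.sqrt (ν j / M)), Literature.Analysis.FunctionSpaces.Torus.gradNormSq (u t) with hI₁
    set I₂ : ℝ := ∫ t in (0 : ℝ)..L, MeasureTheory.integral MeasureTheory.volume
          (fun x : UnitAddTorus (Fin 3) => ((Real.sqrt (ν j / M))⁻¹ * Real.log ‖J t (t + Real.sqrt (ν j / M)) x‖) ^ 2) with hI₂
    have h1 : κ * (c * (L + Real.sqrt (ν j / M))) ≤ κ * (ν j * I₁) := mul_le_mul_of_nonneg_left hfloor hκ.le
    have h2 : 0 ≤ κ * c * Real.sqrt (ν j / M) := mul_nonneg hκc.le (hτpos j).le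
    have h3 : κ * c * L ≤ 2 * (ν j * I₂) := by nlinarith
    rw [div_mul_eq_mul_div, div_le_iff₀ (by positivity)]
    nlinarith
  choose u p D J hNS hLF hEn hBd hfreq using key
  refine ⟨f, hfs, hfd, hfm, ν, fun j => Real.sqrt (ν j / M), u, p, D, J, fun j => (hν j).1, hν0, hNS, fun j => hLF j,
    ⟨E₀, fun j t _ => hEn j t⟩, ⟨M, fun j => ⟨hτpos j, le_of_eq (hτsq j)⟩⟩, κ * c / 4, by positivity, ?_⟩
  intro j
  obtain ⟨Bd, hBd'⟩ := hBd j
  have hlim := le_longTimeAvgSup_of_frequently (b := (κ * c / (2 * ν j)) / 2) hBd' (hfreq j)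
  have hνj := (hν j).1
  have : κ * c / 4 = ν j * ((κ * c / (2 * ν j)) / 2) := by field_simp; ring
  rw [this]
  exact mul_le_mul_of_nonneg_left hlim hνj.le

end Summit.AnomalousDissipation.AnomalousDissipation.Cruxes.KolmogorovHorizonChaos.SplitWindowCapture

end
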